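import Mathlib
import HarnessLib

/-!
# The reduced-order dVOC network and its printed Lyapunov function
# (Groß–Colombino–Brouillon–Dörfler 2019, §II-D, §IV-C/D; Colombino–Groß–Brouillon–Dörfler 2019, §2.2)

Topic `Literature/MathematicalPhysics/PowerSystems`, namespace
`Literature.MathematicalPhysics.PowerSystems` with the grouping sub-namespace `DvocReduced`
(the model's parameter record). THREE COLUMNS: everything here is MODELLED-column mathematics
about the printed REDUCED-ORDER model of `N` grid-forming converters under dispatchable virtual
oscillator control (dVOC) on a quasi-steady-state network; no declaration says that any converter,
microgrid or grid is stable. 0 named facts: every `theorem` below is PROVED from Mathlib; the one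
printed step that is NOT formalized (Lemma 2, the algebraic-connectivity estimate) enters
Proposition 3 as an explicit, instance-checkable hypothesis (`DecreaseOnS`), exactly where the
printed proof invokes it.

Sources (held, read this session on the page; arXiv renderings, `pNNNN` = PDF page of
arXiv:1802.08881 / LaTeX chunk of arXiv:1710.00694):
* [GrossEtAl2019] D. Groß, M. Colombino, J.-S. Brouillon, F. Dörfler, *The effect of
  transmission-line dynamics on grid-forming dispatchable virtual oscillator control*, IEEE Trans.
  Control Netw. Syst. 6 (2019) 1148–1160 = arXiv:1802.08881: (10) p0003; (12), Prop. 1 p0004;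
  (15)–(16) p0004–p0005; Condition 2, Theorem 2 p0005; (17)–(25), Lemma 1, Lemma 2, Prop. 3
  p0006; App.: proof of Prop. 1 (36)–(37) p0010, Lemma 3 (39), proofs of Lemma 1/2 p0011.
* [ColombinoEtAl2019] M. Colombino, D. Groß, J.-S. Brouillon, F. Dörfler, *Global phase and
  magnitude synchronization of coupled oscillators with application to the control of grid-forming
  power inverters*, IEEE TAC 64 (2019) 4496–4511 = arXiv:1710.00694: §2.1 sets `𝒮`, `𝒜`,
  §2.2 (eq. Kk.def), (eq. error theta), Proposition 1 (chunk p0005–p0006).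

> [GrossEtAl2019 (10)] «u_k := ω₀ J v_k + η [K_k v_k − R(κ) i_{o,k} + α Φ_k(v_k) v_k],
> K_k = (1/v_k*²) R(κ) [[p_k*, q_k*], [−q_k*, p_k*]], Φ_k(v_k) := (v_k*² − ‖v_k‖²)/v_k*² I₂.»
> [(12)] «e_{θ,k}(v) := Σ_{(j,k)∈E} ‖Y_jk‖ (v_j − (v_j*/v_k*) R(θ_jk*) v_k).»
> [Prop. 1] «Consider set-points p_k*, q_k*, v_k*, and steady-state angles θ_jk* that satisfy
> Condition 1. It holds that K_k v_k − R(κ) i^s_{o,k} = e_{θ,k}(v).» (proof: (36)–(37), p0010)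
> [(17)] «d/dt v = f_v(v, i^s(v)) = η [(𝒦 − 𝓛) v + α Φ(v) v] … note that (𝒦 − 𝓛) v = e_θ(v)
> which implies (𝒦 − 𝓛) v = 0 for all v ∈ 𝒮.»
> [§IV-D] «S := [v_1* R(θ_11*)ᵀ … v_N* R(θ_1N*)ᵀ]ᵀ and the projector P_S := (I_2N − (1/Σ v_i*²)
> S Sᵀ) onto the nullspace of S … V(v) := ½ vᵀ P_S v + ½ η α α₁ Σ_k ((v_k*² − ‖v_k‖²)/v_k*)²  (19)
> … α₁ := c/(5 η ‖𝒦 − 𝓛‖²)  (20) … ψ(v) := η (‖𝒦 − 𝓛‖ ‖v‖_S + α ‖Φ(v) v‖)  (21).»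
> [Lemma 1] «vᵀ P_S Φ(v) v ≤ vᵀ P_S v = ‖v‖²_S  (22).»
> [Lemma 2] «Consider θ_jk*, α, and c such that Condition 2 is satisfied. For all v ∈ ℝ^{2N},
> vᵀ P_S (𝒦 − 𝓛 + α I_2N) v ≤ −c ‖v‖²_S  (23).»
> [Prop. 3] «… the derivative of V along the trajectories of the reduced-order system (17)
> satisfies d/dt V := (∂V/∂v) f_v(v, i^s(v)) ≤ −α₁ ψ(v)²  (25).» Proof via (26):
> «d/dt V = η vᵀ P_S((𝒦 − 𝓛)v + α Φ(v) v) − 2η² α α₁ vᵀ Φ(v)((𝒦 − 𝓛) v + α Φ(v) v)», Lemma 1,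
> Lemma 2, «(𝒦 − 𝓛) = (𝒦 − 𝓛) P_S», and the 2 × 2 inequality (28)–(29).

## Rendering and what is proved

* State `v = (v_1, …, v_N)`, `v_k ∈ ℝ²`, stored as the pair of coordinate vectors
  `(x, y) : (Fin N → ℝ) × (Fin N → ℝ)` (the convention of the Summits-side typing of the same
  model, so a bridge is definitional). Parameters (`DvocReduced N`): gains `η`, `α`, magnitude
  set-points `v_k*`, steady-state angles `θ_k` (only the differences `θ_jk* = θ_j − θ_k` and the
  rotations `R(θ_k)` enter — node 1 of the print is any reference), and the symmetric nonnegative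
  edge weights `w k j = ‖Y_jk‖` (`0` off the edge set; the diagonal drops out).
* The reduced field is typed in the PHASE-ERROR form `f(v) = η (e_θ(v) + α Φ(v) v)`, which IS
  (17) by the printed identity `(𝒦 − 𝓛) v = e_θ(v)` (ColombinoEtAl2019 Prop. 1, proved here as
  `eθ₁_eq_K_sub_lap`/`eθ₂_eq_K_sub_lap` for the angle form of `K_k`; GrossEtAl2019 Prop. 1 = the
  set-point form under Condition 1 with the uniform `ℓ/r` ratio, proved here as `branchPower_eq`
  (36) and `Kpq_apply_eq_Kang_apply` (37)).
* PROVED: linearity/vanishing of `e_θ` on `𝒮`; `‖v‖²_S = vᵀ P_S v` equals the squared norm of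
  `P_S v` (so it is `≥ 0` and `= 0` iff `v ∈ 𝒮`); the zero set of `V` is `𝒮 ∩ 𝒜`; Lemma 1 (22)
  (by three Cauchy–Schwarz steps — a shorter road than the printed Lemma 3 (39) induction, which
  is therefore not reproduced); the derivative identity (26) along solutions (tree convention
  `HasDerivWithinAt`); and Proposition 3's (25) from (22) + (23)-as-hypothesis + a phase-error
  norm bound `κ₀` standing for `‖𝒦 − 𝓛‖` + the completed square behind (28)–(29), with
  `α₁ = c/(5 η κ₀²)` as printed (20).
* NOT formalized (deliberately): Lemma 2 (needs `λ₂(L)` and [ColombinoEtAl2019, Prop. 7]);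
  the `𝒦∞` sandwich (24); Theorem 2 (line dynamics, singular perturbation). For a concrete
  instance both hypotheses `DecreaseOnS c` and `PhaseErrorBound κ₀` are positive-semidefiniteness
  statements about explicit `2N × 2N` symmetric matrices with the instance's (rational) data, i.e.
  dischargeable by an exact PSD certificate — the use intended downstream.
-/

noncomputable section

namespace Literature.MathematicalPhysics.PowerSystems

open Real Finset

/-- State space of the `N`-converter reduced dVOC model: the stacked terminal-voltage vectors
`v_k = (x_k, y_k) ∈ ℝ²` in a frame rotating at `ω₀`, stored as `(x, y)`.
[cite: GrossEtAl2019, §IV-A eq. (15)] -/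
abbrev DvocState (N : ℕ) : Type := (Fin N → ℝ) × (Fin N → ℝ)

/-- Squared magnitude `‖v_k‖²` of converter `k`'s voltage vector. [folklore] -/
def dvocNsq {N : ℕ} (v : DvocState N) (k : Fin N) : ℝ := v.1 k ^ 2 + v.2 k ^ 2

/-- Euclidean pairing `uᵀ v = Σ_k ⟨u_k, v_k⟩` on `ℝ^{2N}`. [folklore] -/
def dvocDot {N : ℕ} (u v : DvocState N) : ℝ := ∑ k, (u.1 k * v.1 k + u.2 k * v.2 k)

/-- Parameters of the reduced-order dVOC network in phase-error form [cite: GrossEtAl2019, §II-D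
(10), (12), §IV-C (17)]: synchronisation gain `η`, voltage-regulation gain `α`, magnitude
set-points `v_k*` (`vref`), steady-state angles `θ_k` (so `θ_jk* = θ_j − θ_k`), and edge weights
`w k j = ‖Y_jk‖ = 1/√(r_jk² + ω₀²ℓ_jk²)` (symmetric, nonnegative, zero off the edge set and on
the diagonal — the printed sums run over edges `(j,k) ∈ E` of a simple graph).
MODELLED: quasi-steady-state lines (`i_o = i^s_o(v)`), uniform `ℓ/r` ratio (Assumption 1),
consistent set-points (Condition 1) already traded for the angles via Prop. 1. -/
structure DvocReduced (N : ℕ) where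
  /-- synchronisation gain `η` -/
  η : ℝ
  /-- voltage-regulation gain `α` (inside `η`, as in (10)) -/
  α : ℝ
  /-- voltage-magnitude set-points `v_k*` -/
  vref : Fin N → ℝ
  /-- steady-state voltage angles `θ_k` (relative angles `θ_jk* = θ_j − θ_k`) -/
  θ : Fin N → ℝ
  /-- edge weights `‖Y_jk‖` of the transmission graph -/
  w : Fin N → Fin N → ℝ

namespace DvocReduced

variable {N : ℕ} (W : DvocReduced N)

/-! ## §1 The reduced-order field (17) in phase-error form -/

/-- First component of the weighted phase error `e_{θ,k}(v) = Σ_j ‖Y_jk‖ (v_j − (v_j*/v_k*)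
R(θ_jk*) v_k)` [cite: GrossEtAl2019, eq. (12)] (= [ColombinoEtAl2019, eq. (error theta)]);
`R(φ)(a, b) = (cos φ a − sin φ b, sin φ a + cos φ b)`. -/
def eθ₁ (v : DvocState N) (k : Fin N) : ℝ :=
  ∑ j, W.w k j * (v.1 j - W.vref j / W.vref k *
    (cos (W.θ j - W.θ k) * v.1 k - sin (W.θ j - W.θ k) * v.2 k))

/-- Second component of `e_{θ,k}(v)` [cite: GrossEtAl2019, eq. (12)]. -/
def eθ₂ (v : DvocState N) (k : Fin N) : ℝ :=
  ∑ j, W.w k j * (v.2 j - W.vref j / W.vref k *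
    (sin (W.θ j - W.θ k) * v.1 k + cos (W.θ j - W.θ k) * v.2 k))

/-- The stacked phase error `e_θ(v) ∈ ℝ^{2N}`. [cite: GrossEtAl2019, eq. (12)] -/
def eθ (v : DvocState N) : DvocState N := (fun k => W.eθ₁ v k, fun k => W.eθ₂ v k)

/-- Normalised quadratic voltage error `Φ_k(v_k) = (v_k*² − ‖v_k‖²)/v_k*²`
[cite: GrossEtAl2019, eq. (10)]. -/
def Phi (v : DvocState N) (k : Fin N) : ℝ := (W.vref k ^ 2 - dvocNsq v k) / W.vref k ^ 2

/-- The magnitude-error vector `Φ(v) v` (blockwise `Φ_k(v_k) v_k`). [cite: GrossEtAl2019, §IV-D] -/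
def PhiVec (v : DvocState N) : DvocState N :=
  (fun k => W.Phi v k * v.1 k, fun k => W.Phi v k * v.2 k)

/-- First component of `g_k(v) := e_{θ,k}(v) + α Φ_k(v_k) v_k`, the bracket of (17).
[cite: GrossEtAl2019, eq. (17)] -/
def g₁ (v : DvocState N) (k : Fin N) : ℝ := W.eθ₁ v k + W.α * W.Phi v k * v.1 k

/-- Second component of `g_k(v)`. [cite: GrossEtAl2019, eq. (17)] -/
def g₂ (v : DvocState N) (k : Fin N) : ℝ := W.eθ₂ v k + W.α * W.Phi v k * v.2 k

/-- The stacked bracket `g(v) = e_θ(v) + α Φ(v) v`. [cite: GrossEtAl2019, eq. (17)] -/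
def gVec (v : DvocState N) : DvocState N := (fun k => W.g₁ v k, fun k => W.g₂ v k)

/-- The reduced-order dVOC network field `f(v) = η [e_θ(v) + α Φ(v) v]`, i.e. (17)
`η[(𝒦 − 𝓛)v + αΦ(v)v]` with `(𝒦 − 𝓛)v = e_θ(v)` (Prop. 1). [cite: GrossEtAl2019, eq. (17)] -/
def field (v : DvocState N) : DvocState N := (fun k => W.η * W.g₁ v k, fun k => W.η * W.g₂ v k)

/-- Solutions of `dv/dt = f(v)` on a time set `s` (tree convention: `HasDerivWithinAt` within `s`).
[cite: GrossEtAl2019, eq. (17)] -/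
def IsSolutionOn (γ : ℝ → DvocState N) (s : Set ℝ) : Prop :=
  ∀ t ∈ s, HasDerivWithinAt γ (W.field (γ t)) s t

/-! ## §2 Proposition 1: `(𝒦 − 𝓛) v = e_θ(v)` (angle form) and `K_k` from set-points (36)–(37) -/

/-- First component of the ANGLE form of `K_k` applied to `v_k`:
`K_k v_k = Σ_j ‖Y_jk‖ (I₂ − (v_j*/v_k*) R(θ_jk*)) v_k` [cite: ColombinoEtAl2019, eq. (Kk.def)]. -/
def Kang₁ (v : DvocState N) (k : Fin N) : ℝ :=
  ∑ j, W.w k j * (v.1 k - W.vref j / W.vref k *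
    (cos (W.θ j - W.θ k) * v.1 k - sin (W.θ j - W.θ k) * v.2 k))

/-- Second component of the angle form of `K_k v_k`. [cite: ColombinoEtAl2019, eq. (Kk.def)] -/
def Kang₂ (v : DvocState N) (k : Fin N) : ℝ :=
  ∑ j, W.w k j * (v.2 k - W.vref j / W.vref k *
    (sin (W.θ j - W.θ k) * v.1 k + cos (W.θ j - W.θ k) * v.2 k))

/-- First component of the extended Laplacian `(𝓛 v)_k = Σ_j ‖Y_jk‖ (v_k − v_j)`,
`𝓛 = L ⊗ I₂`, `L = B diag(‖Y_l‖) Bᵀ`. [cite: GrossEtAl2019, §II-B] -/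
def lap₁ (v : DvocState N) (k : Fin N) : ℝ := ∑ j, W.w k j * (v.1 k - v.1 j)

/-- Second component of `(𝓛 v)_k`. [cite: GrossEtAl2019, §II-B] -/
def lap₂ (v : DvocState N) (k : Fin N) : ℝ := ∑ j, W.w k j * (v.2 k - v.2 j)

/-- **ColombinoEtAl2019 Proposition 1 / GrossEtAl2019 (17)**: `e_{θ,k}(v) = K_k v_k − (𝓛 v)_k`,
first component. [cite: ColombinoEtAl2019, Prop. 1] -/
theorem eθ₁_eq_K_sub_lap (v : DvocState N) (k : Fin N) :
    W.eθ₁ v k = W.Kang₁ v k - W.lap₁ v k := by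
  simp only [eθ₁, Kang₁, lap₁, ← Finset.sum_sub_distrib]
  exact Finset.sum_congr rfl fun j _ => by ring

/-- `e_{θ,k}(v) = K_k v_k − (𝓛 v)_k`, second component. [cite: ColombinoEtAl2019, Prop. 1] -/
theorem eθ₂_eq_K_sub_lap (v : DvocState N) (k : Fin N) :
    W.eθ₂ v k = W.Kang₂ v k - W.lap₂ v k := by
  simp only [eθ₂, Kang₂, lap₂, ← Finset.sum_sub_distrib]
  exact Finset.sum_congr rfl fun j _ => by ring

/-- Condition 1's steady-state ACTIVE branch power as printed,
`p_jk* := ‖Y_jk‖² (v_k*² r_jk − v_k* v_j* (r_jk cos θ_jk* + ω₀ℓ_jk sin θ_jk*))`, for line data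
`r = r_jk`, `x = ω₀ℓ_jk` [cite: GrossEtAl2019, Condition 1]. -/
def pBranchRX (r x : ℝ) (k j : Fin N) : ℝ :=
  W.w k j ^ 2 * (W.vref k ^ 2 * r
    - W.vref k * W.vref j * (r * cos (W.θ j - W.θ k) + x * sin (W.θ j - W.θ k)))

/-- Condition 1's steady-state REACTIVE branch power as printed,
`q_jk* := ‖Y_jk‖² (v_k*² ω₀ℓ_jk − v_k* v_j* (ω₀ℓ_jk cos θ_jk* − r_jk sin θ_jk*))`
[cite: GrossEtAl2019, Condition 1]. -/
def qBranchRX (r x : ℝ) (k j : Fin N) : ℝ :=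
  W.w k j ^ 2 * (W.vref k ^ 2 * x
    - W.vref k * W.vref j * (x * cos (W.θ j - W.θ k) - r * sin (W.θ j - W.θ k)))

/-- The branch powers in the `κ`-form (36):
`p_jk* = v_k*² ‖Y_jk‖ (cos κ − (v_j*/v_k*) cos(θ_jk* − κ))` [cite: GrossEtAl2019, eq. (36)]. -/
def pBranch (κ : ℝ) (k j : Fin N) : ℝ :=
  W.vref k ^ 2 * W.w k j * (cos κ - W.vref j / W.vref k * cos (W.θ j - W.θ k - κ))

/-- `q_jk* = v_k*² ‖Y_jk‖ (sin κ + (v_j*/v_k*) sin(θ_jk* − κ))` [cite: GrossEtAl2019, eq. (36)]. -/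
def qBranch (κ : ℝ) (k j : Fin N) : ℝ :=
  W.vref k ^ 2 * W.w k j * (sin κ + W.vref j / W.vref k * sin (W.θ j - W.θ k - κ))

/-- **(36)**: under the uniform-ratio identities `r_jk ‖Y_jk‖ = cos κ`, `ω₀ℓ_jk ‖Y_jk‖ = sin κ`
(Assumption 1 with `κ = tan⁻¹(ρω₀)`, `‖Y_jk‖ = 1/√(r_jk² + ω₀²ℓ_jk²)`) the printed Condition-1
branch powers take the `κ`-form (36). Requires `v_k* ≠ 0`. [cite: GrossEtAl2019, eq. (36)] -/
theorem branchPower_eq {κ r x : ℝ} {k j : Fin N} (hk : W.vref k ≠ 0)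
    (hr : r * W.w k j = cos κ) (hx : x * W.w k j = sin κ) :
    W.pBranchRX r x k j = W.pBranch κ k j ∧ W.qBranchRX r x k j = W.qBranch κ k j := by
  have hc : cos (W.θ j - W.θ k - κ)
      = cos (W.θ j - W.θ k) * cos κ + sin (W.θ j - W.θ k) * sin κ := Real.cos_sub _ _
  have hs : sin (W.θ j - W.θ k - κ)
      = sin (W.θ j - W.θ k) * cos κ - cos (W.θ j - W.θ k) * sin κ := Real.sin_sub _ _
  have hρ : W.vref k ^ 2 * (W.vref j / W.vref k) = W.vref k * W.vref j := by
    rw [pow_two, mul_assoc, mul_div_cancel₀ _ hk]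
  constructor
  · simp only [pBranchRX, pBranch]
    rw [hc, ← hr, ← hx]
    linear_combination
      (W.w k j ^ 2 * (r * cos (W.θ j - W.θ k) + x * sin (W.θ j - W.θ k))) * hρ
  · simp only [qBranchRX, qBranch]
    rw [hs, ← hr, ← hx]
    linear_combination
      (W.w k j ^ 2 * (x * cos (W.θ j - W.θ k) - r * sin (W.θ j - W.θ k))) * hρ

/-- Consistent ACTIVE power set-point of node `k`: `p_k* = Σ_j p_jk*` [cite: GrossEtAl2019,
Condition 1] (written with the `κ`-form (36) of the branch powers). -/
def pSet (κ : ℝ) (k : Fin N) : ℝ := ∑ j, W.pBranch κ k j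

/-- Consistent REACTIVE power set-point `q_k* = Σ_j q_jk*` [cite: GrossEtAl2019, Condition 1]. -/
def qSet (κ : ℝ) (k : Fin N) : ℝ := ∑ j, W.qBranch κ k j

/-- First component of the SET-POINT form `K_k v_k = (1/v_k*²) R(κ) [[p_k*, q_k*],[−q_k*, p_k*]]
v_k` of the dVOC gain [cite: GrossEtAl2019, eq. (10)], for given `(p, q) = (p_k*, q_k*)` and
`vr = v_k*`, applied to `v_k = (a, b)`. -/
def Kpq₁ (κ p q vr a b : ℝ) : ℝ :=
  1 / vr ^ 2 * (cos κ * (p * a + q * b) - sin κ * (-(q * a) + p * b))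

/-- Second component of the set-point form of `K_k v_k`. [cite: GrossEtAl2019, eq. (10)] -/
def Kpq₂ (κ p q vr a b : ℝ) : ℝ :=
  1 / vr ^ 2 * (sin κ * (p * a + q * b) + cos κ * (-(q * a) + p * b))

/-- **GrossEtAl2019 Proposition 1 via (37)**: with CONSISTENT set-points `p_k* = Σ_j p_jk*`,
`q_k* = Σ_j q_jk*` (Condition 1, branch powers in the form (36)), the set-point form of the dVOC
gain equals the angle form: `(1/v_k*²) R(κ) [[p_k*, q_k*],[−q_k*, p_k*]] v_k = Σ_j ‖Y_jk‖ (I₂ −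
(v_j*/v_k*) R(θ_jk*)) v_k` — hence `K_k v_k − R(κ) i^s_{o,k} = e_{θ,k}(v)` once `R(κ) i^s_o = 𝓛 v`.
Both components; requires `v_k* ≠ 0`. [cite: GrossEtAl2019, Prop. 1] -/
theorem Kpq_apply_eq_Kang_apply (κ : ℝ) (v : DvocState N) {k : Fin N} (hk : W.vref k ≠ 0) :
    Kpq₁ κ (W.pSet κ k) (W.qSet κ k) (W.vref k) (v.1 k) (v.2 k) = W.Kang₁ v k ∧
      Kpq₂ κ (W.pSet κ k) (W.qSet κ k) (W.vref k) (v.1 k) (v.2 k) = W.Kang₂ v k := by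
  have sc := sin_sq_add_cos_sq κ
  have hc : ∀ j, cos (W.θ j - W.θ k - κ)
      = cos (W.θ j - W.θ k) * cos κ + sin (W.θ j - W.θ k) * sin κ := fun j => Real.cos_sub _ _
  have hs : ∀ j, sin (W.θ j - W.θ k - κ)
      = sin (W.θ j - W.θ k) * cos κ - cos (W.θ j - W.θ k) * sin κ := fun j => Real.sin_sub _ _
  have hinv : 1 / W.vref k ^ 2 * W.vref k ^ 2 = 1 := by
    rw [one_div, inv_mul_cancel₀ (pow_ne_zero 2 hk)]
  -- linearity of the set-point form in `(p, q)`
  have lin1 : ∀ P Q : ℝ, Kpq₁ κ P Q (W.vref k) (v.1 k) (v.2 k)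
      = P * (1 / W.vref k ^ 2 * (cos κ * v.1 k - sin κ * v.2 k))
        + Q * (1 / W.vref k ^ 2 * (cos κ * v.2 k + sin κ * v.1 k)) := fun P Q => by
    simp only [Kpq₁]; ring
  have lin2 : ∀ P Q : ℝ, Kpq₂ κ P Q (W.vref k) (v.1 k) (v.2 k)
      = P * (1 / W.vref k ^ 2 * (sin κ * v.1 k + cos κ * v.2 k))
        + Q * (1 / W.vref k ^ 2 * (sin κ * v.2 k - cos κ * v.1 k)) := fun P Q => by
    simp only [Kpq₂]; ring
  -- per-edge identity (37), both rows
  have row : ∀ j,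
      Kpq₁ κ (W.pBranch κ k j) (W.qBranch κ k j) (W.vref k) (v.1 k) (v.2 k)
        = W.w k j * (v.1 k - W.vref j / W.vref k *
            (cos (W.θ j - W.θ k) * v.1 k - sin (W.θ j - W.θ k) * v.2 k)) ∧
      Kpq₂ κ (W.pBranch κ k j) (W.qBranch κ k j) (W.vref k) (v.1 k) (v.2 k)
        = W.w k j * (v.2 k - W.vref j / W.vref k *
            (sin (W.θ j - W.θ k) * v.1 k + cos (W.θ j - W.θ k) * v.2 k)) := by
    intro j
    simp only [Kpq₁, Kpq₂, pBranch, qBranch]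
    rw [hc j, hs j]
    constructor
    · linear_combination (W.w k j * (v.1 k - W.vref j / W.vref k *
          (cos (W.θ j - W.θ k) * v.1 k - sin (W.θ j - W.θ k) * v.2 k))
          * (sin κ ^ 2 + cos κ ^ 2)) * hinv
        + (W.w k j * (v.1 k - W.vref j / W.vref k *
          (cos (W.θ j - W.θ k) * v.1 k - sin (W.θ j - W.θ k) * v.2 k))) * sc
    · linear_combination (W.w k j * (v.2 k - W.vref j / W.vref k *
          (sin (W.θ j - W.θ k) * v.1 k + cos (W.θ j - W.θ k) * v.2 k))
          * (sin κ ^ 2 + cos κ ^ 2)) * hinv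
        + (W.w k j * (v.2 k - W.vref j / W.vref k *
          (sin (W.θ j - W.θ k) * v.1 k + cos (W.θ j - W.θ k) * v.2 k))) * sc
  constructor
  · calc Kpq₁ κ (W.pSet κ k) (W.qSet κ k) (W.vref k) (v.1 k) (v.2 k)
        = ∑ j, Kpq₁ κ (W.pBranch κ k j) (W.qBranch κ k j) (W.vref k) (v.1 k) (v.2 k) := by
          rw [lin1, pSet, qSet, Finset.sum_mul, Finset.sum_mul, ← Finset.sum_add_distrib]
          exact Finset.sum_congr rfl fun j _ => (lin1 _ _).symm
      _ = W.Kang₁ v k := by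
          unfold Kang₁
          exact Finset.sum_congr rfl fun j _ => (row j).1
  · calc Kpq₂ κ (W.pSet κ k) (W.qSet κ k) (W.vref k) (v.1 k) (v.2 k)
        = ∑ j, Kpq₂ κ (W.pBranch κ k j) (W.qBranch κ k j) (W.vref k) (v.1 k) (v.2 k) := by
          rw [lin2, pSet, qSet, Finset.sum_mul, Finset.sum_mul, ← Finset.sum_add_distrib]
          exact Finset.sum_congr rfl fun j _ => (lin2 _ _).symm
      _ = W.Kang₂ v k := by
          unfold Kang₂
          exact Finset.sum_congr rfl fun j _ => (row j).2

/-! ## §3 The synchronous set `𝒮`, the projector `P_S` and `‖v‖_S` -/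

/-- `Λ := Σ_i v_i*²`, the normalisation of the projector `P_S = I − (1/Σ v_i*²) S Sᵀ`.
[cite: GrossEtAl2019, §IV-D] -/
def Lam : ℝ := ∑ k, W.vref k ^ 2

/-- The `S`-matrix embedding `ℝ² → ℝ^{2N}`, `(a, b) ↦ (v_k* R(θ_k) (a, b))_k`; its range is the
synchronous set `𝒮` [cite: GrossEtAl2019, §IV-D] (print: `S := [v_1* R(θ_11*)ᵀ … v_N* R(θ_1N*)ᵀ]ᵀ`,
`R(θ_1k*)ᵀ = R(θ_k − θ_1)`; the common rotation by `θ_1` is immaterial). -/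
def embS (a b : ℝ) : DvocState N :=
  (fun k => W.vref k * (cos (W.θ k) * a - sin (W.θ k) * b),
   fun k => W.vref k * (sin (W.θ k) * a + cos (W.θ k) * b))

/-- Membership in the synchronous set `𝒮 = {v | v_k/v_k* = R(θ_k1*) v_1/v_1* ∀k}` = range of the
`S`-matrix [cite: ColombinoEtAl2019, §2.1 eq. (S)]. -/
def InS (v : DvocState N) : Prop := ∃ a b : ℝ, v = W.embS a b

/-- First component of `Sᵀ v = Σ_k v_k* R(θ_k)ᵀ v_k ∈ ℝ²`. [cite: GrossEtAl2019, §IV-D] -/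
def sig₁ (v : DvocState N) : ℝ := ∑ k, W.vref k * (cos (W.θ k) * v.1 k + sin (W.θ k) * v.2 k)

/-- Second component of `Sᵀ v`. [cite: GrossEtAl2019, §IV-D] -/
def sig₂ (v : DvocState N) : ℝ := ∑ k, W.vref k * (-sin (W.θ k) * v.1 k + cos (W.θ k) * v.2 k)

/-- The bilinear form `uᵀ P_S v = uᵀ v − (1/Λ) (Sᵀu)ᵀ(Sᵀv)` of the projector
`P_S = I_2N − (1/Σ v_i*²) S Sᵀ`. [cite: GrossEtAl2019, §IV-D] -/
def qS (u v : DvocState N) : ℝ :=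
  dvocDot u v - (W.sig₁ u * W.sig₁ v + W.sig₂ u * W.sig₂ v) / W.Lam

/-- `‖v‖²_S := vᵀ P_S v` [cite: GrossEtAl2019, eq. (22)]. -/
def normS2 (v : DvocState N) : ℝ := W.qS v v

/-- The projection `P_S v = v − (1/Λ) S Sᵀ v`. [cite: GrossEtAl2019, §IV-D] -/
def projS (v : DvocState N) : DvocState N := v - W.embS (W.sig₁ v / W.Lam) (W.sig₂ v / W.Lam)

/-- `Λ ≥ 0`. [folklore] -/
private theorem Lam_nonneg : 0 ≤ W.Lam := Finset.sum_nonneg fun _ _ => sq_nonneg _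

/-- `Λ = Σ v_i*² > 0` when all `v_k* > 0` and `N ≥ 1` — the normalisation `1/Σ v_i*²` of the
printed projector is well defined. [cite: GrossEtAl2019, §IV-D] -/
theorem Lam_pos [NeZero N] (hv : ∀ k, 0 < W.vref k) : 0 < W.Lam :=
  Finset.sum_pos (fun k _ => pow_pos (hv k) 2) Finset.univ_nonempty

/-- `Sᵀ S = Λ I₂`: `Sᵀ (S(a,b)) = (Λ a, Λ b)`. [cite: GrossEtAl2019, §IV-D] -/
theorem sig_embS (a b : ℝ) :
    W.sig₁ (W.embS a b) = W.Lam * a ∧ W.sig₂ (W.embS a b) = W.Lam * b := by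
  constructor
  · simp only [sig₁, embS, Lam, Finset.sum_mul]
    refine Finset.sum_congr rfl fun k _ => ?_
    have sc := sin_sq_add_cos_sq (W.θ k)
    linear_combination (W.vref k ^ 2 * a) * sc
  · simp only [sig₂, embS, Lam, Finset.sum_mul]
    refine Finset.sum_congr rfl fun k _ => ?_
    have sc := sin_sq_add_cos_sq (W.θ k)
    linear_combination (W.vref k ^ 2 * b) * sc

/-- `Sᵀ` is linear: components of `Sᵀ(u − v)`. [folklore] -/
private theorem sig_sub (u v : DvocState N) :
    W.sig₁ (u - v) = W.sig₁ u - W.sig₁ v ∧ W.sig₂ (u - v) = W.sig₂ u - W.sig₂ v := by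
  constructor
  · simp only [sig₁, Prod.fst_sub, Prod.snd_sub, Pi.sub_apply, ← Finset.sum_sub_distrib]
    exact Finset.sum_congr rfl fun k _ => by ring
  · simp only [sig₂, Prod.fst_sub, Prod.snd_sub, Pi.sub_apply, ← Finset.sum_sub_distrib]
    exact Finset.sum_congr rfl fun k _ => by ring

/-- `P_S v` is annihilated by `Sᵀ` (it lies in `𝒮^⊥ = ker Sᵀ`); requires `Λ ≠ 0`.
[cite: GrossEtAl2019, §IV-D] -/
theorem sig_projS (hΛ : W.Lam ≠ 0) (v : DvocState N) :
    W.sig₁ (W.projS v) = 0 ∧ W.sig₂ (W.projS v) = 0 := by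
  obtain ⟨h1, h2⟩ := W.sig_sub v (W.embS (W.sig₁ v / W.Lam) (W.sig₂ v / W.Lam))
  obtain ⟨e1, e2⟩ := W.sig_embS (W.sig₁ v / W.Lam) (W.sig₂ v / W.Lam)
  simp only [projS]
  constructor
  · rw [h1, e1, mul_div_cancel₀ _ hΛ, sub_self]
  · rw [h2, e2, mul_div_cancel₀ _ hΛ, sub_self]

/-- `Σ_k ‖u_k‖² = uᵀ u`. [folklore] -/
private theorem sum_nsq_eq_dot (u : DvocState N) : ∑ k, dvocNsq u k = dvocDot u u :=
  Finset.sum_congr rfl fun k _ => by simp only [dvocNsq]; ring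

/-- `(u − e)ᵀ(u − e) = uᵀu − 2 uᵀe + eᵀe`. [folklore] -/
private theorem dot_sub_sub (u e : DvocState N) :
    dvocDot (u - e) (u - e) = dvocDot u u - 2 * dvocDot u e + dvocDot e e := by
  simp only [dvocDot, Prod.fst_sub, Prod.snd_sub, Pi.sub_apply, Finset.mul_sum,
    ← Finset.sum_sub_distrib, ← Finset.sum_add_distrib]
  exact Finset.sum_congr rfl fun k _ => by ring

/-- `vᵀ S(a, b) = a (Sᵀv)₁ + b (Sᵀv)₂`. [cite: GrossEtAl2019, §IV-D] -/
theorem dot_embS (v : DvocState N) (a b : ℝ) :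
    dvocDot v (W.embS a b) = a * W.sig₁ v + b * W.sig₂ v := by
  simp only [dvocDot, embS, sig₁, sig₂, Finset.mul_sum, ← Finset.sum_add_distrib]
  exact Finset.sum_congr rfl fun k _ => by ring

/-- `S(a, b)ᵀ S(a, b) = Λ (a² + b²)` (columns of `S` are orthogonal of squared length `Λ`).
[cite: GrossEtAl2019, §IV-D] -/
theorem dot_embS_self (a b : ℝ) : dvocDot (W.embS a b) (W.embS a b) = W.Lam * (a ^ 2 + b ^ 2) := by
  simp only [dvocDot, embS, Lam, Finset.sum_mul]
  refine Finset.sum_congr rfl fun k _ => ?_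
  have sc := sin_sq_add_cos_sq (W.θ k)
  linear_combination (W.vref k ^ 2 * (a ^ 2 + b ^ 2)) * sc

/-- `vᵀ v − (1/Λ)‖Sᵀ v‖² = ‖P_S v‖²`: the quadratic form of the projector is the squared norm of
the projection (P_S symmetric idempotent, `SᵀS = Λ I₂`); requires `Λ ≠ 0`.
[cite: GrossEtAl2019, §IV-D] -/
theorem normS2_eq_sum_nsq_projS (hΛ : W.Lam ≠ 0) (v : DvocState N) :
    W.normS2 v = ∑ k, dvocNsq (W.projS v) k := by
  rw [sum_nsq_eq_dot, projS, dot_sub_sub, W.dot_embS, W.dot_embS_self]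
  simp only [normS2, qS]
  field_simp
  ring

/-- `‖v‖²_S ≥ 0` (requires `Λ ≠ 0`). [cite: GrossEtAl2019, eq. (22)] -/
theorem normS2_nonneg (hΛ : W.Lam ≠ 0) (v : DvocState N) : 0 ≤ W.normS2 v := by
  rw [W.normS2_eq_sum_nsq_projS hΛ]
  exact Finset.sum_nonneg fun k _ => by unfold dvocNsq; positivity

/-- Elements of `𝒮`: `‖S(a,b)‖²_S = 0` (requires `Λ ≠ 0`). [cite: GrossEtAl2019, §IV-D] -/
theorem normS2_embS (hΛ : W.Lam ≠ 0) (a b : ℝ) : W.normS2 (W.embS a b) = 0 := by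
  obtain ⟨e1, e2⟩ := W.sig_embS a b
  simp only [normS2, qS, W.dot_embS_self, e1, e2]
  rw [show (W.Lam * a * (W.Lam * a) + W.Lam * b * (W.Lam * b)) / W.Lam = W.Lam * (a ^ 2 + b ^ 2) by
    field_simp]
  ring

/-- **Zero set of `‖·‖_S`**: `‖v‖²_S = 0 ↔ v ∈ 𝒮` (requires `Λ ≠ 0`). [cite: GrossEtAl2019, §IV-D] -/
theorem normS2_eq_zero_iff (hΛ : W.Lam ≠ 0) (v : DvocState N) : W.normS2 v = 0 ↔ W.InS v := by
  constructor
  · intro h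
    rw [W.normS2_eq_sum_nsq_projS hΛ] at h
    have hk : ∀ k, dvocNsq (W.projS v) k = 0 := fun k =>
      (Finset.sum_eq_zero_iff_of_nonneg fun j _ => by unfold dvocNsq; positivity).1 h k
        (Finset.mem_univ k)
    refine ⟨W.sig₁ v / W.Lam, W.sig₂ v / W.Lam, ?_⟩
    have hp : W.projS v = 0 := by
      refine Prod.ext (funext fun k => ?_) (funext fun k => ?_)
      · have := hk k
        unfold dvocNsq at this
        have h0 : (W.projS v).1 k = 0 := by
          nlinarith [sq_nonneg ((W.projS v).1 k), sq_nonneg ((W.projS v).2 k)]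
        simpa using h0
      · have := hk k
        unfold dvocNsq at this
        have h0 : (W.projS v).2 k = 0 := by
          nlinarith [sq_nonneg ((W.projS v).1 k), sq_nonneg ((W.projS v).2 k)]
        simpa using h0
    have : v - W.embS (W.sig₁ v / W.Lam) (W.sig₂ v / W.Lam) = 0 := hp
    exact (sub_eq_zero.1 this)
  · rintro ⟨a, b, rfl⟩
    exact W.normS2_embS hΛ a b

/-! ## §4 The phase error vanishes on `𝒮` and factors through `P_S` -/

/-- The printed phase error (12) is LINEAR in `v`: `e_θ(u − v) = e_θ(u) − e_θ(v)`
(componentwise). [cite: GrossEtAl2019, eq. (12)] -/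
theorem eθ_sub (u v : DvocState N) (k : Fin N) :
    W.eθ₁ (u - v) k = W.eθ₁ u k - W.eθ₁ v k ∧ W.eθ₂ (u - v) k = W.eθ₂ u k - W.eθ₂ v k := by
  constructor
  · simp only [eθ₁, Prod.fst_sub, Prod.snd_sub, Pi.sub_apply, ← Finset.sum_sub_distrib]
    exact Finset.sum_congr rfl fun j _ => by ring
  · simp only [eθ₂, Prod.fst_sub, Prod.snd_sub, Pi.sub_apply, ← Finset.sum_sub_distrib]
    exact Finset.sum_congr rfl fun j _ => by ring

/-- **`(𝒦 − 𝓛) v = 0` for `v ∈ 𝒮`** [cite: GrossEtAl2019, §IV-C after (17)]: on the range of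
the `S`-matrix every summand of `e_{θ,k}` vanishes, because `R(θ_j − θ_k) R(θ_k) = R(θ_j)`.
Requires `v_k* ≠ 0`. -/
theorem eθ_embS (a b : ℝ) {k : Fin N} (hk : W.vref k ≠ 0) :
    W.eθ₁ (W.embS a b) k = 0 ∧ W.eθ₂ (W.embS a b) k = 0 := by
  have hc : ∀ j, cos (W.θ j - W.θ k) = cos (W.θ j) * cos (W.θ k) + sin (W.θ j) * sin (W.θ k) :=
    fun j => Real.cos_sub _ _
  have hs : ∀ j, sin (W.θ j - W.θ k) = sin (W.θ j) * cos (W.θ k) - cos (W.θ j) * sin (W.θ k) :=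
    fun j => Real.sin_sub _ _
  have sck := sin_sq_add_cos_sq (W.θ k)
  have hρ : ∀ j, W.vref j / W.vref k * W.vref k = W.vref j := fun j => div_mul_cancel₀ _ hk
  constructor
  · simp only [eθ₁, embS]
    refine Finset.sum_eq_zero fun j _ => ?_
    rw [hc j, hs j]
    linear_combination
      (-(W.w k j * (cos (W.θ j) * a - sin (W.θ j) * b) * W.vref j)) * sck
      + (-(W.w k j * (cos (W.θ j) * a - sin (W.θ j) * b)
          * (sin (W.θ k) ^ 2 + cos (W.θ k) ^ 2))) * hρ j
  · simp only [eθ₂, embS]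
    refine Finset.sum_eq_zero fun j _ => ?_
    rw [hc j, hs j]
    linear_combination
      (-(W.w k j * (sin (W.θ j) * a + cos (W.θ j) * b) * W.vref j)) * sck
      + (-(W.w k j * (sin (W.θ j) * a + cos (W.θ j) * b)
          * (sin (W.θ k) ^ 2 + cos (W.θ k) ^ 2))) * hρ j

/-- Hence `e_θ(v) = 0` for every `v ∈ 𝒮` (all `v_k* ≠ 0`). [cite: GrossEtAl2019, §IV-C] -/
theorem eθ_of_InS {v : DvocState N} (hv : W.InS v) (hne : ∀ k, W.vref k ≠ 0) : W.eθ v = 0 := by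
  obtain ⟨a, b, rfl⟩ := hv
  refine Prod.ext (funext fun k => ?_) (funext fun k => ?_)
  · simpa [eθ] using (W.eθ_embS a b (hne k)).1
  · simpa [eθ] using (W.eθ_embS a b (hne k)).2

/-- **`(𝒦 − 𝓛) = (𝒦 − 𝓛) P_S`** [cite: GrossEtAl2019, proof of Prop. 3]: the phase error only
sees the `𝒮^⊥`-component, `e_θ(P_S v) = e_θ(v)` (all `v_k* ≠ 0`). -/
theorem eθ_projS (hne : ∀ k, W.vref k ≠ 0) (v : DvocState N) (k : Fin N) :
    W.eθ₁ (W.projS v) k = W.eθ₁ v k ∧ W.eθ₂ (W.projS v) k = W.eθ₂ v k := by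
  obtain ⟨h1, h2⟩ := W.eθ_sub v (W.embS (W.sig₁ v / W.Lam) (W.sig₂ v / W.Lam)) k
  obtain ⟨z1, z2⟩ := W.eθ_embS (W.sig₁ v / W.Lam) (W.sig₂ v / W.Lam) (hne k)
  exact ⟨by rw [projS, h1, z1, sub_zero], by rw [projS, h2, z2, sub_zero]⟩

/-! ## §5 The Lyapunov function (19), its zero set, and Lemma 1 (22) -/

/-- The printed Lyapunov function candidate of the reduced-order system,
`V(v) := ½ vᵀ P_S v + ½ η α α₁ Σ_k ((v_k*² − ‖v_k‖²)/v_k*)²` [cite: GrossEtAl2019, eq. (19)],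
with the weight `α₁` kept as a parameter (print: `α₁ := c/(5η‖𝒦 − 𝓛‖²)`, (20); here `alpha1`). -/
def V (α₁ : ℝ) (v : DvocState N) : ℝ :=
  1 / 2 * W.normS2 v
    + 1 / 2 * W.η * W.α * α₁ * ∑ k, (W.vref k ^ 2 - dvocNsq v k) ^ 2 / W.vref k ^ 2

/-- The printed choice `α₁ := c/(5 η κ₀²)` with `κ₀` standing for `‖𝒦 − 𝓛‖`
[cite: GrossEtAl2019, eq. (20)]. -/
def alpha1 (c κ₀ : ℝ) : ℝ := c / (5 * W.η * κ₀ ^ 2)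

/-- `V ≥ 0` when `Λ ≠ 0` and `η α α₁ ≥ 0`. [cite: GrossEtAl2019, Prop. 3 (24)] -/
theorem V_nonneg (hΛ : W.Lam ≠ 0) {α₁ : ℝ} (hw : 0 ≤ W.η * W.α * α₁) (v : DvocState N) :
    0 ≤ W.V α₁ v := by
  have h1 := W.normS2_nonneg hΛ v
  have h2 : 0 ≤ ∑ k, (W.vref k ^ 2 - dvocNsq v k) ^ 2 / W.vref k ^ 2 :=
    Finset.sum_nonneg fun k _ => by positivity
  unfold V
  nlinarith

/-- **Zero set of `V`** («`V` is positive definite with respect to `𝒮 ∩ 𝒜`, i.e. `V = 0` for all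
`v ∈ 𝒮 ∩ 𝒜` and `V(v) > 0` otherwise», [cite: GrossEtAl2019, proof of Prop. 3]): for `Λ ≠ 0`,
`η α α₁ > 0` and all `v_k* ≠ 0`, `V(v) = 0 ↔ v ∈ 𝒮 ∧ ‖v_k‖² = v_k*² ∀k`. -/
theorem V_eq_zero_iff (hΛ : W.Lam ≠ 0) {α₁ : ℝ} (hw : 0 < W.η * W.α * α₁)
    (hne : ∀ k, W.vref k ≠ 0) (v : DvocState N) :
    W.V α₁ v = 0 ↔ W.InS v ∧ ∀ k, dvocNsq v k = W.vref k ^ 2 := by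
  have h1 := W.normS2_nonneg hΛ v
  have hterm : ∀ k, 0 ≤ (W.vref k ^ 2 - dvocNsq v k) ^ 2 / W.vref k ^ 2 := fun k => by positivity
  have h2 : 0 ≤ ∑ k, (W.vref k ^ 2 - dvocNsq v k) ^ 2 / W.vref k ^ 2 :=
    Finset.sum_nonneg fun k _ => hterm k
  constructor
  · intro h
    unfold V at h
    have hn : W.normS2 v = 0 := by nlinarith
    have hs : ∑ k, (W.vref k ^ 2 - dvocNsq v k) ^ 2 / W.vref k ^ 2 = 0 := by nlinarith
    refine ⟨(W.normS2_eq_zero_iff hΛ v).1 hn, fun k => ?_⟩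
    have hk := (Finset.sum_eq_zero_iff_of_nonneg fun j _ => hterm j).1 hs k (Finset.mem_univ k)
    have h2k : W.vref k ^ 2 ≠ 0 := pow_ne_zero 2 (hne k)
    rcases div_eq_zero_iff.1 hk with hsq | hden
    · have := (pow_eq_zero_iff (n := 2) (by norm_num)).1 hsq
      linarith
    · exact absurd hden h2k
  · rintro ⟨hS, hA⟩
    have hn : W.normS2 v = 0 := (W.normS2_eq_zero_iff hΛ v).2 hS
    have hs : ∑ k, (W.vref k ^ 2 - dvocNsq v k) ^ 2 / W.vref k ^ 2 = 0 :=
      Finset.sum_eq_zero fun k _ => by rw [hA k]; simp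
    simp [V, hn, hs]

/-- `v_k* Φ_k(v_k) = v_k* − ‖v_k‖²/v_k*` (`v_k* ≠ 0`). [folklore] -/
private theorem vref_mul_Phi {v : DvocState N} {k : Fin N} (hk : W.vref k ≠ 0) :
    W.vref k * W.Phi v k = W.vref k - dvocNsq v k / W.vref k := by
  unfold Phi
  field_simp

/-- `‖v_k‖² Φ_k(v_k) = ‖v_k‖² − ‖v_k‖⁴/v_k*²`. [folklore] -/
private theorem nsq_mul_Phi (v : DvocState N) {k : Fin N} (hk : W.vref k ≠ 0) :
    dvocNsq v k * W.Phi v k = dvocNsq v k - dvocNsq v k ^ 2 / W.vref k ^ 2 := by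
  unfold Phi
  field_simp

/-- A sum-splitting Cauchy–Schwarz inequality on `ℝ^{2N}`:
`(Σ_k (p_k q_k + p'_k q'_k))² ≤ (Σ_k (p_k² + p'_k²)) (Σ_k (q_k² + q'_k²))`. [folklore] -/
private theorem cauchySchwarz_pair (p p' q q' : Fin N → ℝ) :
    (∑ k, (p k * q k + p' k * q' k)) ^ 2
      ≤ (∑ k, (p k ^ 2 + p' k ^ 2)) * ∑ k, (q k ^ 2 + q' k ^ 2) := by
  have h := Finset.sum_mul_sq_le_sq_mul_sq (Finset.univ : Finset (Fin N ⊕ Fin N))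
    (Sum.elim p p') (Sum.elim q q')
  simpa only [Fintype.sum_sum_type, Sum.elim_inl, Sum.elim_inr, Finset.sum_add_distrib] using h

/-- **Lemma 1 (22)** [cite: GrossEtAl2019, Lemma 1]: `vᵀ P_S Φ(v) v ≤ vᵀ P_S v = ‖v‖²_S` for all
`v`, provided all `v_k* > 0` (and `N ≥ 1`). Printed proof: Lemma 3 (39) with `m = 3`; here three
Cauchy–Schwarz steps give the same bound `(Sᵀ D v)ᵀ(Sᵀ v) ≤ Λ Σ_k ‖v_k‖⁴/v_k*²`,
`D = diag(‖v_k‖²/v_k*²)`, directly. -/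
theorem qS_PhiVec_le_normS2 [NeZero N] (hv : ∀ k, 0 < W.vref k) (v : DvocState N) :
    W.qS v (W.PhiVec v) ≤ W.normS2 v := by
  have hΛ : 0 < W.Lam := W.Lam_pos hv
  have hne : ∀ k, W.vref k ≠ 0 := fun k => (hv k).ne'
  -- rotated coordinates `u_k = R(θ_k)ᵀ v_k` and squared magnitudes `n_k = ‖v_k‖²`
  set u1 : Fin N → ℝ := fun k => cos (W.θ k) * v.1 k + sin (W.θ k) * v.2 k with hu1
  set u2 : Fin N → ℝ := fun k => -sin (W.θ k) * v.1 k + cos (W.θ k) * v.2 k with hu2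
  set n : Fin N → ℝ := fun k => dvocNsq v k with hn
  have hun : ∀ k, u1 k ^ 2 + u2 k ^ 2 = n k := by
    intro k
    have sc := sin_sq_add_cos_sq (W.θ k)
    simp only [hu1, hu2, hn, dvocNsq]
    linear_combination (v.1 k ^ 2 + v.2 k ^ 2) * sc
  have hn0 : ∀ k, 0 ≤ n k := fun k => by simp only [hn, dvocNsq]; positivity
  -- the four sums
  set T : ℝ := ∑ k, n k with hT
  set X : ℝ := ∑ k, n k ^ 2 / W.vref k ^ 2 with hX
  set σ1 : ℝ := ∑ k, W.vref k * u1 k with hσ1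
  set σ2 : ℝ := ∑ k, W.vref k * u2 k with hσ2
  set a1 : ℝ := ∑ k, n k / W.vref k * u1 k with ha1
  set a2 : ℝ := ∑ k, n k / W.vref k * u2 k with ha2
  have hsig1 : W.sig₁ v = σ1 := by simp only [sig₁, hσ1, hu1]
  have hsig2 : W.sig₂ v = σ2 := by simp only [sig₂, hσ2, hu2]
  have hsigP1 : W.sig₁ (W.PhiVec v) = σ1 - a1 := by
    rw [hσ1, ha1, ← Finset.sum_sub_distrib]
    simp only [sig₁, PhiVec]
    refine Finset.sum_congr rfl fun k _ => ?_
    calc W.vref k * (cos (W.θ k) * (W.Phi v k * v.1 k) + sin (W.θ k) * (W.Phi v k * v.2 k))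
        = (W.vref k * W.Phi v k) * u1 k := by simp only [hu1]; ring
      _ = (W.vref k - n k / W.vref k) * u1 k := by rw [W.vref_mul_Phi (hne k)]
      _ = W.vref k * u1 k - n k / W.vref k * u1 k := by ring
  have hsigP2 : W.sig₂ (W.PhiVec v) = σ2 - a2 := by
    rw [hσ2, ha2, ← Finset.sum_sub_distrib]
    simp only [sig₂, PhiVec]
    refine Finset.sum_congr rfl fun k _ => ?_
    calc W.vref k * (-sin (W.θ k) * (W.Phi v k * v.1 k) + cos (W.θ k) * (W.Phi v k * v.2 k))
        = (W.vref k * W.Phi v k) * u2 k := by simp only [hu2]; ring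
      _ = (W.vref k - n k / W.vref k) * u2 k := by rw [W.vref_mul_Phi (hne k)]
      _ = W.vref k * u2 k - n k / W.vref k * u2 k := by ring
  have hdotP : dvocDot v (W.PhiVec v) = T - X := by
    rw [hT, hX, ← Finset.sum_sub_distrib]
    simp only [dvocDot, PhiVec]
    refine Finset.sum_congr rfl fun k _ => ?_
    calc v.1 k * (W.Phi v k * v.1 k) + v.2 k * (W.Phi v k * v.2 k)
        = dvocNsq v k * W.Phi v k := by simp only [dvocNsq]; ring
      _ = n k - n k ^ 2 / W.vref k ^ 2 := by rw [W.nsq_mul_Phi v (hne k)]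
  have hdot : dvocDot v v = T := by
    rw [hT]
    simp only [dvocDot, hn, dvocNsq]
    exact Finset.sum_congr rfl fun k _ => by ring
  -- the difference `‖v‖²_S − vᵀ P_S Φ(v) v = X − ⟨σ, a⟩/Λ`
  have hdiff : W.normS2 v - W.qS v (W.PhiVec v) = X - (σ1 * a1 + σ2 * a2) / W.Lam := by
    simp only [normS2, qS, hdot, hdotP, hsig1, hsig2, hsigP1, hsigP2]
    field_simp
    ring
  -- Cauchy–Schwarz ×4 (all square-free)
  have cs1 : (σ1 * a1 + σ2 * a2) ^ 2 ≤ (σ1 ^ 2 + σ2 ^ 2) * (a1 ^ 2 + a2 ^ 2) := by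
    nlinarith [sq_nonneg (σ1 * a2 - σ2 * a1)]
  have hsumu : (∑ k, u1 k ^ 2) + ∑ k, u2 k ^ 2 = T := by
    rw [hT, ← Finset.sum_add_distrib]; exact Finset.sum_congr rfl fun k _ => hun k
  have hX' : (∑ k, (n k / W.vref k) ^ 2) = X := by
    rw [hX]; exact Finset.sum_congr rfl fun k _ => by rw [div_pow]
  have cs2 : σ1 ^ 2 + σ2 ^ 2 ≤ W.Lam * T := by
    have e1 := Finset.sum_mul_sq_le_sq_mul_sq Finset.univ (fun k => W.vref k) u1
    have e2 := Finset.sum_mul_sq_le_sq_mul_sq Finset.univ (fun k => W.vref k) u2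
    rw [← hσ1] at e1
    rw [← hσ2] at e2
    have hL : (∑ k, W.vref k ^ 2) = W.Lam := rfl
    rw [hL] at e1 e2
    rw [← hsumu, mul_add]
    exact add_le_add e1 e2
  have cs3 : a1 ^ 2 + a2 ^ 2 ≤ X * T := by
    have e1 := Finset.sum_mul_sq_le_sq_mul_sq Finset.univ (fun k => n k / W.vref k) u1
    have e2 := Finset.sum_mul_sq_le_sq_mul_sq Finset.univ (fun k => n k / W.vref k) u2
    rw [← ha1, hX'] at e1
    rw [← ha2, hX'] at e2
    rw [← hsumu, mul_add]
    exact add_le_add e1 e2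
  have cs4 : T ^ 2 ≤ W.Lam * X := by
    have e := Finset.sum_mul_sq_le_sq_mul_sq Finset.univ (fun k => W.vref k)
      (fun k => n k / W.vref k)
    have hT' : (∑ k, W.vref k * (n k / W.vref k)) = T := by
      rw [hT]; exact Finset.sum_congr rfl fun k _ => mul_div_cancel₀ _ (hne k)
    have hL : (∑ k, W.vref k ^ 2) = W.Lam := rfl
    rw [hT', hX', hL] at e
    exact e
  have hT0 : 0 ≤ T := Finset.sum_nonneg fun k _ => hn0 k
  have hX0 : 0 ≤ X := Finset.sum_nonneg fun k _ => by positivity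
  -- `⟨σ,a⟩² ≤ (ΛT)(XT) = ΛX·T² ≤ (ΛX)²`
  have key : (σ1 * a1 + σ2 * a2) ^ 2 ≤ (W.Lam * X) ^ 2 := by
    have hB : 0 ≤ a1 ^ 2 + a2 ^ 2 := by positivity
    calc (σ1 * a1 + σ2 * a2) ^ 2 ≤ (σ1 ^ 2 + σ2 ^ 2) * (a1 ^ 2 + a2 ^ 2) := cs1
      _ ≤ (W.Lam * T) * (X * T) := mul_le_mul cs2 cs3 hB (by positivity)
      _ = (W.Lam * X) * T ^ 2 := by ring
      _ ≤ (W.Lam * X) * (W.Lam * X) := mul_le_mul_of_nonneg_left cs4 (by positivity)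
      _ = (W.Lam * X) ^ 2 := by ring
  have key' : σ1 * a1 + σ2 * a2 ≤ W.Lam * X :=
    (abs_le_of_sq_le_sq' key (by positivity)).2
  have : 0 ≤ X - (σ1 * a1 + σ2 * a2) / W.Lam := by
    rw [sub_nonneg, div_le_iff₀ hΛ]
    linarith
  linarith [hdiff]

/-! ## §6 The derivative identity (26) along solutions -/

/-- The printed expression (26) for `dV/dt` along (17), in phase-error form:
`η vᵀ P_S g(v) − 2 η² α α₁ Σ_k Φ_k(v_k) ⟨v_k, g_k(v)⟩`, `g = e_θ + α Φ(v) v`.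
[cite: GrossEtAl2019, eq. (26)] -/
def Vdot (α₁ : ℝ) (v : DvocState N) : ℝ :=
  W.η * W.qS v (W.gVec v)
    - 2 * W.η ^ 2 * W.α * α₁ * ∑ k, W.Phi v k * (v.1 k * W.g₁ v k + v.2 k * W.g₂ v k)

/-- Coordinate form of (17) along a solution: `ẋ_k = η g_{k,1}(v)`. [cite: GrossEtAl2019, eq. (17)] -/
theorem hasDerivWithinAt_fst {γ : ℝ → DvocState N} {s : Set ℝ} {t : ℝ}
    (hγ : HasDerivWithinAt γ (W.field (γ t)) s t) (k : Fin N) :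
    HasDerivWithinAt (fun τ => (γ τ).1 k) (W.η * W.g₁ (γ t) k) s t := by
  have h1 : HasDerivWithinAt (fun τ => (γ τ).1) (W.field (γ t)).1 s t := by
    simpa using hγ.hasFDerivWithinAt.fst.hasDerivWithinAt
  simpa [field] using (hasDerivWithinAt_pi.1 h1) k

/-- Coordinate form of (17) along a solution: `ẏ_k = η g_{k,2}(v)`. [cite: GrossEtAl2019, eq. (17)] -/
theorem hasDerivWithinAt_snd {γ : ℝ → DvocState N} {s : Set ℝ} {t : ℝ}
    (hγ : HasDerivWithinAt γ (W.field (γ t)) s t) (k : Fin N) :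
    HasDerivWithinAt (fun τ => (γ τ).2 k) (W.η * W.g₂ (γ t) k) s t := by
  have h2 : HasDerivWithinAt (fun τ => (γ τ).2) (W.field (γ t)).2 s t := by
    simpa using hγ.hasFDerivWithinAt.snd.hasDerivWithinAt
  simpa [field] using (hasDerivWithinAt_pi.1 h2) k

/-- **(26)**: along any solution of the reduced-order system (17) the printed Lyapunov function
(19) has derivative `Vdot` (tree convention: within `s` at `t`). [cite: GrossEtAl2019, eq. (26)] -/
theorem hasDerivWithinAt_V (α₁ : ℝ) {γ : ℝ → DvocState N} {s : Set ℝ} {t : ℝ}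
    (hγ : HasDerivWithinAt γ (W.field (γ t)) s t) :
    HasDerivWithinAt (fun τ => W.V α₁ (γ τ)) (W.Vdot α₁ (γ t)) s t := by
  have h1 := W.hasDerivWithinAt_fst hγ
  have h2 := W.hasDerivWithinAt_snd hγ
  -- abbreviations for the coordinate velocities
  set f1 : Fin N → ℝ := fun k => W.η * W.g₁ (γ t) k with hf1
  set f2 : Fin N → ℝ := fun k => W.η * W.g₂ (γ t) k with hf2
  -- squared magnitudes
  have hn : ∀ k, HasDerivWithinAt (fun τ => dvocNsq (γ τ) k)
      (2 * ((γ t).1 k * f1 k + (γ t).2 k * f2 k)) s t := by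
    intro k
    have := ((h1 k).mul (h1 k)).add ((h2 k).mul (h2 k))
    have hf : (fun τ => dvocNsq (γ τ) k)
        = fun τ => (γ τ).1 k * (γ τ).1 k + (γ τ).2 k * (γ τ).2 k := by
      funext τ; simp only [dvocNsq]; ring
    rw [hf]
    refine this.congr_deriv ?_
    simp only [hf1, hf2]
    ring
  -- `vᵀ v`
  have hdot : HasDerivWithinAt (fun τ => dvocDot (γ τ) (γ τ))
      (∑ k, 2 * ((γ t).1 k * f1 k + (γ t).2 k * f2 k)) s t := by
    have := HasDerivWithinAt.fun_sum (u := Finset.univ) fun k _ => hn k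
    have hf : (fun τ => dvocDot (γ τ) (γ τ)) = fun τ => ∑ k, dvocNsq (γ τ) k := by
      funext τ; simp only [dvocDot, dvocNsq]; exact Finset.sum_congr rfl fun k _ => by ring
    rw [hf]
    exact this
  -- `Sᵀ v`
  have hs1 : HasDerivWithinAt (fun τ => W.sig₁ (γ τ))
      (∑ k, W.vref k * (cos (W.θ k) * f1 k + sin (W.θ k) * f2 k)) s t := by
    have := HasDerivWithinAt.fun_sum (u := Finset.univ) fun k _ =>
      (((h1 k).const_mul (cos (W.θ k))).add ((h2 k).const_mul (sin (W.θ k)))).const_mul (W.vref k)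
    have hf : (fun τ => W.sig₁ (γ τ))
        = fun τ => ∑ k, W.vref k * (cos (W.θ k) * (γ τ).1 k + sin (W.θ k) * (γ τ).2 k) := by
      funext τ; simp only [sig₁]
    rw [hf]
    exact this
  have hs2 : HasDerivWithinAt (fun τ => W.sig₂ (γ τ))
      (∑ k, W.vref k * (-sin (W.θ k) * f1 k + cos (W.θ k) * f2 k)) s t := by
    have := HasDerivWithinAt.fun_sum (u := Finset.univ) fun k _ =>
      (((h1 k).const_mul (-sin (W.θ k))).add ((h2 k).const_mul (cos (W.θ k)))).const_mul
        (W.vref k)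
    have hf : (fun τ => W.sig₂ (γ τ))
        = fun τ => ∑ k, W.vref k * (-sin (W.θ k) * (γ τ).1 k + cos (W.θ k) * (γ τ).2 k) := by
      funext τ; simp only [sig₂]
    rw [hf]
    exact this
  -- penalty terms
  have hp : ∀ k, HasDerivWithinAt (fun τ => (W.vref k ^ 2 - dvocNsq (γ τ) k) ^ 2 / W.vref k ^ 2)
      (2 * (W.vref k ^ 2 - dvocNsq (γ t) k) *
        (-(2 * ((γ t).1 k * f1 k + (γ t).2 k * f2 k))) / W.vref k ^ 2) s t := by
    intro k
    have hc : HasDerivWithinAt (fun τ => W.vref k ^ 2 - dvocNsq (γ τ) k)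
        (-(2 * ((γ t).1 k * f1 k + (γ t).2 k * f2 k))) s t := by
      simpa using (hn k).const_sub (W.vref k ^ 2)
    have := (hc.pow 2).div_const (W.vref k ^ 2)
    refine this.congr_deriv ?_
    simp only [Nat.cast_ofNat]
    ring
  have hpen : HasDerivWithinAt
      (fun τ => ∑ k, (W.vref k ^ 2 - dvocNsq (γ τ) k) ^ 2 / W.vref k ^ 2)
      (∑ k, 2 * (W.vref k ^ 2 - dvocNsq (γ t) k) *
        (-(2 * ((γ t).1 k * f1 k + (γ t).2 k * f2 k))) / W.vref k ^ 2) s t :=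
    HasDerivWithinAt.fun_sum (u := Finset.univ) fun k _ => hp k
  -- assemble `V`
  have hq := (hdot.sub (((hs1.mul hs1).add (hs2.mul hs2)).div_const W.Lam)).const_mul (1 / 2)
  have hV := hq.add (hpen.const_mul (1 / 2 * W.η * W.α * α₁))
  have hf : (fun τ => W.V α₁ (γ τ)) = fun τ =>
      1 / 2 * (dvocDot (γ τ) (γ τ)
          - (W.sig₁ (γ τ) * W.sig₁ (γ τ) + W.sig₂ (γ τ) * W.sig₂ (γ τ)) / W.Lam)
        + 1 / 2 * W.η * W.α * α₁ * ∑ k, (W.vref k ^ 2 - dvocNsq (γ τ) k) ^ 2 / W.vref k ^ 2 := by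
    funext τ; simp only [V, normS2, qS]
  rw [hf]
  refine hV.congr_deriv ?_
  -- identify with the printed form (26)
  have e1 : (∑ k, 2 * ((γ t).1 k * f1 k + (γ t).2 k * f2 k))
      = 2 * W.η * dvocDot (γ t) (W.gVec (γ t)) := by
    simp only [dvocDot, gVec, hf1, hf2, Finset.mul_sum]
    exact Finset.sum_congr rfl fun k _ => by ring
  have e2 : (∑ k, W.vref k * (cos (W.θ k) * f1 k + sin (W.θ k) * f2 k))
      = W.η * W.sig₁ (W.gVec (γ t)) := by
    simp only [sig₁, gVec, hf1, hf2, Finset.mul_sum]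
    exact Finset.sum_congr rfl fun k _ => by ring
  have e3 : (∑ k, W.vref k * (-sin (W.θ k) * f1 k + cos (W.θ k) * f2 k))
      = W.η * W.sig₂ (W.gVec (γ t)) := by
    simp only [sig₂, gVec, hf1, hf2, Finset.mul_sum]
    exact Finset.sum_congr rfl fun k _ => by ring
  have e4 : (∑ k, 2 * (W.vref k ^ 2 - dvocNsq (γ t) k) *
        (-(2 * ((γ t).1 k * f1 k + (γ t).2 k * f2 k))) / W.vref k ^ 2)
      = -(4 * W.η) * ∑ k, W.Phi (γ t) k * ((γ t).1 k * W.g₁ (γ t) k + (γ t).2 k * W.g₂ (γ t) k) := by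
    simp only [Phi, hf1, hf2, Finset.mul_sum]
    exact Finset.sum_congr rfl fun k _ => by ring
  rw [e1, e2, e3, e4]
  simp only [Vdot, qS]
  ring

/-! ## §7 Proposition 3: `dV/dt ≤ −α₁ ψ(v)²` (25) -/

/-- The decrease inequality (23) of Lemma 2 as a property of the instance:
`vᵀ P_S (𝒦 − 𝓛 + α I_2N) v ≤ −c ‖v‖²_S` for all `v`, i.e. `vᵀ P_S e_θ(v) + α ‖v‖²_S ≤ −c ‖v‖²_S`.
Print derives it from Condition 2 through `λ₂(L)` [cite: GrossEtAl2019, Lemma 2]; for a concrete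
instance it is positive-semidefiniteness of one explicit symmetric `2N × 2N` matrix. -/
def DecreaseOnS (c : ℝ) : Prop :=
  ∀ v : DvocState N, W.qS v (W.eθ v) + W.α * W.normS2 v ≤ -c * W.normS2 v

/-- The operator-norm step of the printed proof, `‖(𝒦 − 𝓛) v‖ ≤ ‖𝒦 − 𝓛‖ ‖v‖_S` (valid because
`(𝒦 − 𝓛) = (𝒦 − 𝓛) P_S`), as a property of the instance with a constant `κ₀ ≥ ‖𝒦 − 𝓛‖`:
`‖e_θ(v)‖² ≤ κ₀² ‖v‖²_S` for all `v`. [cite: GrossEtAl2019, proof of Prop. 3] -/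
def PhaseErrorBound (κ₀ : ℝ) : Prop :=
  ∀ v : DvocState N, ∑ k, (W.eθ₁ v k ^ 2 + W.eθ₂ v k ^ 2) ≤ κ₀ ^ 2 * W.normS2 v

/-- The comparison function `ψ(v) := η (‖𝒦 − 𝓛‖ ‖v‖_S + α ‖Φ(v) v‖)` [cite: GrossEtAl2019,
eq. (21)], with `κ₀` in place of `‖𝒦 − 𝓛‖`. -/
def psi (κ₀ : ℝ) (v : DvocState N) : ℝ :=
  W.η * (κ₀ * Real.sqrt (W.normS2 v) + W.α * Real.sqrt (∑ k, W.Phi v k ^ 2 * dvocNsq v k))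

/-- The projector form `vᵀ P_S ·` is linear in the second slot, the split used between (26) and
(27): `vᵀ P_S g(v) = vᵀ P_S e_θ(v) + α vᵀ P_S Φ(v) v`. [cite: GrossEtAl2019, eq. (26)–(27)] -/
theorem qS_gVec (v : DvocState N) :
    W.qS v (W.gVec v) = W.qS v (W.eθ v) + W.α * W.qS v (W.PhiVec v) := by
  have hd : dvocDot v (W.gVec v) = dvocDot v (W.eθ v) + W.α * dvocDot v (W.PhiVec v) := by
    simp only [dvocDot, gVec, eθ, PhiVec, g₁, g₂, Finset.mul_sum, ← Finset.sum_add_distrib]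
    exact Finset.sum_congr rfl fun k _ => by ring
  have hs1 : W.sig₁ (W.gVec v) = W.sig₁ (W.eθ v) + W.α * W.sig₁ (W.PhiVec v) := by
    simp only [sig₁, gVec, eθ, PhiVec, g₁, g₂, Finset.mul_sum, ← Finset.sum_add_distrib]
    exact Finset.sum_congr rfl fun k _ => by ring
  have hs2 : W.sig₂ (W.gVec v) = W.sig₂ (W.eθ v) + W.α * W.sig₂ (W.PhiVec v) := by
    simp only [sig₂, gVec, eθ, PhiVec, g₁, g₂, Finset.mul_sum, ← Finset.sum_add_distrib]
    exact Finset.sum_congr rfl fun k _ => by ring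
  simp only [qS, hd, hs1, hs2]
  ring

/-- **Proposition 3 (25)** [cite: GrossEtAl2019, Prop. 3]: for gains `η > 0`, `α ≥ 0`, set-points
`v_k* > 0` (`N ≥ 1`), a margin `c > 0` with the decrease inequality (23) (`DecreaseOnS c`, the
conclusion of Lemma 2 under Condition 2), and a phase-error bound `κ₀ > 0` (`‖𝒦 − 𝓛‖ ≤ κ₀`),
the expression (26) satisfies `dV/dt ≤ −α₁ ψ(v)²` with `α₁ = c/(5ηκ₀²)` (20). The printed chain:
(27) by Lemma 1, then (23), then `|vᵀΦ(v)(𝒦 − 𝓛)v| ≤ ‖Φ(v)v‖ κ₀ ‖v‖_S`, then (28) ⟸ (29), which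
here is the completed square `−α₁η²[(κ₀‖v‖_S + α‖Φv‖)² + (2κ₀‖v‖_S − α‖Φv‖)²]`. -/
theorem Vdot_le_neg_alpha1_psi_sq [NeZero N] (hη : 0 < W.η) (hα : 0 ≤ W.α)
    (hv : ∀ k, 0 < W.vref k) {c κ₀ : ℝ} (hc : 0 < c) (hκ₀ : 0 < κ₀)
    (h23 : W.DecreaseOnS c) (hK : W.PhaseErrorBound κ₀) (v : DvocState N) :
    W.Vdot (W.alpha1 c κ₀) v ≤ -(W.alpha1 c κ₀) * W.psi κ₀ v ^ 2 := by
  have hΛ : 0 < W.Lam := W.Lam_pos hv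
  set α₁ := W.alpha1 c κ₀ with hα₁
  have hα₁pos : 0 < α₁ := by rw [hα₁]; unfold alpha1; positivity
  have hηc : W.η * c = 5 * W.η ^ 2 * α₁ * κ₀ ^ 2 := by
    rw [hα₁]; unfold alpha1; field_simp
  -- the two square roots
  set a := Real.sqrt (W.normS2 v) with ha
  set B := ∑ k, W.Phi v k ^ 2 * dvocNsq v k with hB
  set b := Real.sqrt B with hb
  have hS0 : 0 ≤ W.normS2 v := W.normS2_nonneg hΛ.ne' v
  have hB0 : 0 ≤ B := Finset.sum_nonneg fun k _ => by unfold dvocNsq; positivity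
  have ha2 : a ^ 2 = W.normS2 v := by rw [ha, Real.sq_sqrt hS0]
  have hb2 : b ^ 2 = B := by rw [hb, Real.sq_sqrt hB0]
  have ha0 : 0 ≤ a := Real.sqrt_nonneg _
  have hb0 : 0 ≤ b := Real.sqrt_nonneg _
  -- Step 1, (27) + (23): `η vᵀP_S g ≤ −η c ‖v‖²_S`
  have step1 : W.η * W.qS v (W.gVec v) ≤ -(W.η * c) * a ^ 2 := by
    rw [W.qS_gVec, ha2]
    have l1 := W.qS_PhiVec_le_normS2 hv v
    have l2 := h23 v
    have l1' := mul_le_mul_of_nonneg_left l1 (mul_nonneg hη.le hα)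
    nlinarith
  -- Step 2: the penalty cross term, `Σ Φ_k⟨v_k, g_k⟩ = E + α B` with `|E| ≤ b κ₀ a`
  set E := ∑ k, W.Phi v k * (v.1 k * W.eθ₁ v k + v.2 k * W.eθ₂ v k) with hE
  have hsplit : (∑ k, W.Phi v k * (v.1 k * W.g₁ v k + v.2 k * W.g₂ v k)) = E + W.α * B := by
    rw [hE, hB, Finset.mul_sum, ← Finset.sum_add_distrib]
    exact Finset.sum_congr rfl fun k _ => by simp only [g₁, g₂, dvocNsq]; ring
  have hE2 : E ^ 2 ≤ B * (κ₀ ^ 2 * a ^ 2) := by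
    have cs := cauchySchwarz_pair (fun k => W.Phi v k * v.1 k) (fun k => W.Phi v k * v.2 k)
      (fun k => W.eθ₁ v k) (fun k => W.eθ₂ v k)
    have hE' : (∑ k, (W.Phi v k * v.1 k * W.eθ₁ v k + W.Phi v k * v.2 k * W.eθ₂ v k)) = E := by
      rw [hE]; exact Finset.sum_congr rfl fun k _ => by ring
    have hB' : (∑ k, ((W.Phi v k * v.1 k) ^ 2 + (W.Phi v k * v.2 k) ^ 2)) = B := by
      rw [hB]; exact Finset.sum_congr rfl fun k _ => by simp only [dvocNsq]; ring
    rw [hE', hB'] at cs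
    have hk := hK v
    rw [ha2]
    calc E ^ 2 ≤ B * ∑ k, (W.eθ₁ v k ^ 2 + W.eθ₂ v k ^ 2) := cs
      _ ≤ B * (κ₀ ^ 2 * W.normS2 v) := mul_le_mul_of_nonneg_left hk hB0
  have hEabs : -E ≤ b * (κ₀ * a) := by
    have hsq : E ^ 2 ≤ (b * (κ₀ * a)) ^ 2 := by
      calc E ^ 2 ≤ B * (κ₀ ^ 2 * a ^ 2) := hE2
        _ = (b * (κ₀ * a)) ^ 2 := by rw [← hb2]; ring
    have := (abs_le_of_sq_le_sq' hsq (by positivity)).1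
    linarith
  -- Step 3: assemble and complete the square
  have hcoef : 0 ≤ 2 * W.η ^ 2 * W.α * α₁ := by positivity
  have step2 : -(2 * W.η ^ 2 * W.α * α₁ * ∑ k, W.Phi v k * (v.1 k * W.g₁ v k + v.2 k * W.g₂ v k))
      ≤ -(2 * W.η ^ 2 * W.α ^ 2 * α₁) * b ^ 2 + 2 * W.η ^ 2 * W.α * α₁ * (b * (κ₀ * a)) := by
    rw [hsplit, hb2]
    have := mul_le_mul_of_nonneg_left hEabs hcoef
    nlinarith
  have hpsi : W.psi κ₀ v = W.η * (κ₀ * a + W.α * b) := by simp only [psi, ha, hb, hB]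
  rw [hpsi]
  have htot : -(W.η * c) * a ^ 2 + (-(2 * W.η ^ 2 * W.α ^ 2 * α₁) * b ^ 2
      + 2 * W.η ^ 2 * W.α * α₁ * (b * (κ₀ * a)))
      = -α₁ * (W.η * (κ₀ * a + W.α * b)) ^ 2 - α₁ * W.η ^ 2 * (2 * κ₀ * a - W.α * b) ^ 2 := by
    rw [hηc]; ring
  have hsq0 : 0 ≤ α₁ * W.η ^ 2 * (2 * κ₀ * a - W.α * b) ^ 2 := by positivity
  have hVd : W.Vdot α₁ v = W.η * W.qS v (W.gVec v)
      - 2 * W.η ^ 2 * W.α * α₁ * ∑ k, W.Phi v k * (v.1 k * W.g₁ v k + v.2 k * W.g₂ v k) := rfl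
  rw [hVd]
  linarith [step1, step2, htot, hsq0]

/-- **Corollary (25) along solutions**: under the hypotheses of Proposition 3, along every
solution of (17) the Lyapunov function (19) with the printed weight `α₁ = c/(5ηκ₀²)` has, within
`s` at `t`, a derivative bounded by `−α₁ ψ(v)² ≤ 0`. [cite: GrossEtAl2019, Prop. 3] -/
theorem hasDerivWithinAt_V_le [NeZero N] (hη : 0 < W.η) (hα : 0 ≤ W.α)
    (hv : ∀ k, 0 < W.vref k) {c κ₀ : ℝ} (hc : 0 < c) (hκ₀ : 0 < κ₀)
    (h23 : W.DecreaseOnS c) (hK : W.PhaseErrorBound κ₀)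
    {γ : ℝ → DvocState N} {s : Set ℝ} {t : ℝ} (hγ : HasDerivWithinAt γ (W.field (γ t)) s t) :
    ∃ d : ℝ, HasDerivWithinAt (fun τ => W.V (W.alpha1 c κ₀) (γ τ)) d s t ∧
      d ≤ -(W.alpha1 c κ₀) * W.psi κ₀ (γ t) ^ 2 ∧ d ≤ 0 := by
  refine ⟨W.Vdot (W.alpha1 c κ₀) (γ t), W.hasDerivWithinAt_V _ hγ,
    W.Vdot_le_neg_alpha1_psi_sq hη hα hv hc hκ₀ h23 hK (γ t), ?_⟩
  have h := W.Vdot_le_neg_alpha1_psi_sq hη hα hv hc hκ₀ h23 hK (γ t)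
  have hα₁ : 0 ≤ W.alpha1 c κ₀ := by unfold alpha1; positivity
  nlinarith [sq_nonneg (W.psi κ₀ (γ t))]

/-! ## §8 Interface lemmas for the ODE sentence and for instance certificates

(Append 2026-08-27, same source.) The two hypotheses of Proposition 3 as nonnegativity of ONE
explicit quadratic form each (the shape an exact Gram/PSD certificate discharges); the value of `V`
at the origin and the zero set of `ψ` — the printed target set is `𝒯₀ = 𝒯 ∪ {0}`
[GrossEtAl2019 §IV-A (16) and Thm 1/Thm 2: «the origin 0_n is an (exponentially) unstable
equilibrium»], so a sublevel piece `{V ≤ c}` with `c < V(0)` is the origin-free region on which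
(25) is a strict Lyapunov inequality w.r.t. `𝒮 ∩ 𝒜`; and the elementary sublevel bounds behind
«radially unbounded with respect to 𝒮 ∩ 𝒜» (proof of Prop. 3, (24)). -/

/-- (23) as nonnegativity of one quadratic form in the `2N` coordinates:
`DecreaseOnS c ↔ ∀ v, 0 ≤ −vᵀP_S e_θ(v) − (α + c)‖v‖²_S`. [cite: GrossEtAl2019, Lemma 2 (23)] -/
theorem decreaseOnS_iff (c : ℝ) :
    W.DecreaseOnS c ↔ ∀ v : DvocState N, 0 ≤ -W.qS v (W.eθ v) - (W.α + c) * W.normS2 v := by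
  unfold DecreaseOnS
  constructor
  · intro h v
    have := h v
    linarith
  · intro h v
    have := h v
    linarith

/-- The phase-error bound as nonnegativity of one quadratic form:
`PhaseErrorBound κ₀ ↔ ∀ v, 0 ≤ κ₀²‖v‖²_S − ‖e_θ(v)‖²`. [cite: GrossEtAl2019, proof of Prop. 3] -/
theorem phaseErrorBound_iff (κ₀ : ℝ) :
    W.PhaseErrorBound κ₀ ↔
      ∀ v : DvocState N, 0 ≤ κ₀ ^ 2 * W.normS2 v - ∑ k, (W.eθ₁ v k ^ 2 + W.eθ₂ v k ^ 2) := by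
  unfold PhaseErrorBound
  constructor
  · intro h v
    have := h v
    linarith
  · intro h v
    have := h v
    linarith

/-- `‖0‖²_S = 0` (the origin lies in `𝒮`). [cite: GrossEtAl2019, §IV-A (16)] -/
theorem normS2_zero : W.normS2 (0 : DvocState N) = 0 := by
  simp [normS2, qS, dvocDot, sig₁, sig₂]

/-- The value of the printed Lyapunov function at the origin: `V(0) = ½ η α α₁ Λ`,
`Λ = Σ v_k*²` — the level that separates the origin (the unstable element of `𝒯₀ = 𝒯 ∪ {0}`)
from the sublevel pieces around `𝒮 ∩ 𝒜`. [cite: GrossEtAl2019, §IV-A (16), eq. (19)] -/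
theorem V_zero (α₁ : ℝ) : W.V α₁ (0 : DvocState N) = 1 / 2 * W.η * W.α * α₁ * W.Lam := by
  have hs : ∑ k, (W.vref k ^ 2 - dvocNsq (0 : DvocState N) k) ^ 2 / W.vref k ^ 2 = W.Lam := by
    unfold Lam
    refine Finset.sum_congr rfl fun k _ => ?_
    have h0 : dvocNsq (0 : DvocState N) k = 0 := by simp [dvocNsq]
    rw [h0, sub_zero]
    rcases eq_or_ne (W.vref k) 0 with h | h
    · simp [h]
    · field_simp
  rw [V, W.normS2_zero, hs]
  ring

/-- Squared magnitudes on `𝒮`: `‖(S(a,b))_k‖² = v_k*² (a² + b²)`. [cite: GrossEtAl2019, §IV-D] -/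
theorem nsq_embS (a b : ℝ) (k : Fin N) :
    dvocNsq (W.embS a b) k = W.vref k ^ 2 * (a ^ 2 + b ^ 2) := by
  have sc := sin_sq_add_cos_sq (W.θ k)
  simp only [dvocNsq, embS]
  linear_combination (W.vref k ^ 2 * (a ^ 2 + b ^ 2)) * sc

/-- **Zero set of `ψ`** (21): for `η, α, κ₀ > 0`, all `v_k* > 0` and `N ≥ 1`,
`ψ(v) = 0 ↔ v ∈ 𝒮 ∩ 𝒜 ∨ v = 0` — i.e. exactly the printed set `𝒯₀ = 𝒯 ∪ {0}` (in the reduced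
model's coordinates), so (25) is strict off `𝒯₀`. [cite: GrossEtAl2019, §IV-A (16), Prop. 3] -/
theorem psi_eq_zero_iff [NeZero N] (hη : 0 < W.η) (hα : 0 < W.α) {κ₀ : ℝ} (hκ₀ : 0 < κ₀)
    (hv : ∀ k, 0 < W.vref k) (v : DvocState N) :
    W.psi κ₀ v = 0 ↔ (W.InS v ∧ ∀ k, dvocNsq v k = W.vref k ^ 2) ∨ v = 0 := by
  have hΛ : W.Lam ≠ 0 := (W.Lam_pos hv).ne'
  have hne : ∀ k, W.vref k ≠ 0 := fun k => (hv k).ne'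
  set B := ∑ k, W.Phi v k ^ 2 * dvocNsq v k with hB
  have hS0 : 0 ≤ W.normS2 v := W.normS2_nonneg hΛ v
  have hterm : ∀ k, 0 ≤ W.Phi v k ^ 2 * dvocNsq v k := fun k => by unfold dvocNsq; positivity
  have hB0 : 0 ≤ B := Finset.sum_nonneg fun k _ => hterm k
  -- `ψ = 0 ↔ ‖v‖²_S = 0 ∧ B = 0`
  have key : W.psi κ₀ v = 0 ↔ W.normS2 v = 0 ∧ B = 0 := by
    constructor
    · intro h
      have h1 : 0 ≤ κ₀ * Real.sqrt (W.normS2 v) := by positivity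
      have h2 : 0 ≤ W.α * Real.sqrt B := by positivity
      have hsum : κ₀ * Real.sqrt (W.normS2 v) + W.α * Real.sqrt B = 0 := by
        have := mul_eq_zero.1 h
        rcases this with h0 | h0
        · exact absurd h0 hη.ne'
        · simpa [hB] using h0
      have ha : Real.sqrt (W.normS2 v) = 0 := by nlinarith [Real.sqrt_nonneg (W.normS2 v)]
      have hb : Real.sqrt B = 0 := by nlinarith [Real.sqrt_nonneg B]
      exact ⟨(Real.sqrt_eq_zero hS0).1 ha, (Real.sqrt_eq_zero hB0).1 hb⟩
    · rintro ⟨h1, h2⟩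
      simp only [psi, ← hB, h1, h2, Real.sqrt_zero, mul_zero, add_zero]
  rw [key, W.normS2_eq_zero_iff hΛ]
  -- `B = 0 ↔ ∀ k, Φ_k = 0 ∨ ‖v_k‖² = 0`
  have hBz : B = 0 ↔ ∀ k, W.Phi v k = 0 ∨ dvocNsq v k = 0 := by
    rw [hB, Finset.sum_eq_zero_iff_of_nonneg fun k _ => hterm k]
    simp only [Finset.mem_univ, true_implies, mul_eq_zero, pow_eq_zero_iff two_ne_zero]
  rw [hBz]
  have hΦ : ∀ k, W.Phi v k = 0 ↔ dvocNsq v k = W.vref k ^ 2 := by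
    intro k
    have h2 : W.vref k ^ 2 ≠ 0 := pow_ne_zero 2 (hne k)
    rw [Phi, div_eq_zero_iff, sub_eq_zero]
    constructor
    · rintro (h | h)
      · exact h.symm
      · exact absurd h h2
    · intro h
      exact Or.inl h.symm
  simp only [hΦ]
  constructor
  · rintro ⟨hS, hk⟩
    obtain ⟨a, b, rfl⟩ := hS
    -- on `𝒮` the dichotomy is uniform in `k`
    have k0 : Fin N := ⟨0, Nat.pos_of_ne_zero (NeZero.ne N)⟩
    rcases hk k0 with h | h
    · left
      refine ⟨⟨a, b, rfl⟩, fun k => ?_⟩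
      rw [W.nsq_embS] at h ⊢
      have hab : a ^ 2 + b ^ 2 = 1 := by
        have := mul_left_cancel₀ (pow_ne_zero 2 (hne k0)) (h.trans (mul_one _).symm)
        exact this
      rw [hab, mul_one]
    · right
      rw [W.nsq_embS] at h
      have hab : a ^ 2 + b ^ 2 = 0 := by
        rcases mul_eq_zero.1 h with h' | h'
        · exact absurd h' (pow_ne_zero 2 (hne k0))
        · exact h'
      have ha : a = 0 := by nlinarith [sq_nonneg a, sq_nonneg b]
      have hb : b = 0 := by nlinarith [sq_nonneg a, sq_nonneg b]
      subst ha; subst hb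
      refine Prod.ext (funext fun k => ?_) (funext fun k => ?_) <;> simp [embS]
  · rintro (⟨hS, hA⟩ | rfl)
    · exact ⟨hS, fun k => Or.inl (hA k)⟩
    · refine ⟨⟨0, 0, ?_⟩, fun k => Or.inr ?_⟩
      · refine Prod.ext (funext fun k => ?_) (funext fun k => ?_) <;> simp [embS]
      · simp [dvocNsq]

/-- Sublevel bound, projector part: `V(v) ≤ c` and `η α α₁ ≥ 0` give `‖v‖²_S ≤ 2c`.
[cite: GrossEtAl2019, Prop. 3 (24)] -/
theorem normS2_le_of_V_le {α₁ c : ℝ} (hw : 0 ≤ W.η * W.α * α₁) {v : DvocState N}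
    (h : W.V α₁ v ≤ c) : W.normS2 v ≤ 2 * c := by
  have h2 : 0 ≤ ∑ k, (W.vref k ^ 2 - dvocNsq v k) ^ 2 / W.vref k ^ 2 :=
    Finset.sum_nonneg fun k _ => by positivity
  unfold V at h
  nlinarith

/-- Sublevel bound, magnitude part: `V(v) ≤ c`, `Λ ≠ 0`, `η α α₁ > 0` give, for every converter,
`(v_k*² − ‖v_k‖²)² ≤ (2c/(ηαα₁)) v_k*²` — the quartic penalty of (19) confines every `‖v_k‖`,
which is the coercivity behind (24). [cite: GrossEtAl2019, Prop. 3 (24)] -/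
theorem penalty_le_of_V_le (hΛ : W.Lam ≠ 0) {α₁ c : ℝ} (hw : 0 < W.η * W.α * α₁)
    {v : DvocState N} (h : W.V α₁ v ≤ c) {k : Fin N} (hk0 : W.vref k ≠ 0) :
    (W.vref k ^ 2 - dvocNsq v k) ^ 2 ≤ 2 * c / (W.η * W.α * α₁) * W.vref k ^ 2 := by
  have h1 := W.normS2_nonneg hΛ v
  have hterm : ∀ j, 0 ≤ (W.vref j ^ 2 - dvocNsq v j) ^ 2 / W.vref j ^ 2 := fun j => by positivity
  have hk : (W.vref k ^ 2 - dvocNsq v k) ^ 2 / W.vref k ^ 2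
      ≤ ∑ j, (W.vref j ^ 2 - dvocNsq v j) ^ 2 / W.vref j ^ 2 :=
    Finset.single_le_sum (fun j _ => hterm j) (Finset.mem_univ k)
  unfold V at h
  have hsum : ∑ j, (W.vref j ^ 2 - dvocNsq v j) ^ 2 / W.vref j ^ 2 ≤ 2 * c / (W.η * W.α * α₁) := by
    rw [le_div_iff₀ hw]
    nlinarith
  have hk' := hk.trans hsum
  have h2 : 0 < W.vref k ^ 2 := by positivity
  rwa [div_le_iff₀ h2] at hk'

/-- Hence on `{V ≤ c}` every squared magnitude is bounded:
`‖v_k‖² ≤ v_k*² + √(2c/(ηαα₁)) · |v_k*|` (`v_k* ≠ 0`). [cite: GrossEtAl2019, Prop. 3 (24)] -/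
theorem nsq_le_of_V_le (hΛ : W.Lam ≠ 0) {α₁ c : ℝ} (hw : 0 < W.η * W.α * α₁)
    {v : DvocState N} (h : W.V α₁ v ≤ c) {k : Fin N} (hk0 : W.vref k ≠ 0) :
    dvocNsq v k ≤ W.vref k ^ 2 + Real.sqrt (2 * c / (W.η * W.α * α₁)) * |W.vref k| := by
  have hp := W.penalty_le_of_V_le hΛ hw h hk0
  have hM : 0 ≤ 2 * c / (W.η * W.α * α₁) := by
    have : 0 ≤ (W.vref k ^ 2 - dvocNsq v k) ^ 2 := sq_nonneg _
    have h2 : 0 < W.vref k ^ 2 := by positivity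
    nlinarith
  have habs : |W.vref k ^ 2 - dvocNsq v k| ≤ Real.sqrt (2 * c / (W.η * W.α * α₁)) * |W.vref k| := by
    have := Real.abs_le_sqrt hp
    rwa [Real.sqrt_mul hM, Real.sqrt_sq_eq_abs] at this
  have := (abs_le.1 habs).1
  linarith

end DvocReduced

end Literature.MathematicalPhysics.PowerSystems

end
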